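import Summits.QuantumFields.YangMills.Theorems.FlatTubeReductionSymmetricKernelPrelim
import HarnessLib

/-!
# Prelims for the MOMENT FORM of the symmetric kernel ratio lemma: first-order exponential expansion and tilted covariance with SECOND-MOMENT remainders, and a weighted
# Cauchy–Schwarz inequality
# (route `FlatTubeReduction`, crux K1 `NearFlatRatioLaw` stmt-QuantumFields-24720; seat `ym-line-ftr-p1` g15; rate twin «ratepack-v4 / Gaussian fibres, moment-based near pair»;
# R2b1 RECORD rung — no summit statement is proved here)

WHY (memo `Cruxes/NearFlatRatioLaw/Lines/ratepack-v4-moments-g15.md` §3(a)).  The sup-form `…SymmetricKernelRatio.symmetric_kernel_ratio` (rate `ξ + 120η²`, `η` = sup of the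
exponent differences on the profile support) forces the fibre profile to have support radius `β^{-1/2}` exactly: at the radius `β^{-1/2}√log β` that the (B-OD)-rate brick needs
(an `O(λ_b)`-quasimode profile) the sup picks up `log β` and `η²` loses `log²β` against the budget `λ_b²`.  The logs live in suprema, not in moments: this file re-proves the
lemma with the second-order term controlled by `v ≥ ⟨A²⟩_{ρ₁}/F₁₁, ⟨A'²⟩_{ρ₂}/F₂₂, ⟨Z²⟩_{ρ₁}/F₁₁` (`A = E₁₂ − E₁₁`, `A' = E₂₁ − E₂₂`, `Z = E₂₂ − E₁₁`, `ρ₁ = qe^{E₁₁}`,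
`ρ₂ = qe^{E₂₂}`), keeping `|·| ≤ η ≤ 1` pointwise only inside `e^{±2η} ≤ e²`.
* `exp_moment_first_order_var` (`0 ≤ ∫qe^{E'} − ∫qe^{E} − ∫qe^{E}A ≤ ∫qe^{E}A²`), `exp_tilt_covariance_var` (`0 ≤ F·J − G·I ≤ e^{c}·F·∫ρZ²`),
  `sq_integral_mul_le` (Cauchy–Schwarz `(∫ρA)² ≤ (∫ρ)(∫ρA²)`); the lemma itself is `…SymmetricKernelRatioVar.symmetric_kernel_ratio_var`.
HONEST FRAMING: elementary real analysis (no physics); the first atom of the moment-based repair of the rate twin's near-pair step; femto rung R2b1 (RECORD label); not infinite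
volume, not a gap, not Clay.  No defs, no named facts, no `sorry`.
(g16: comment-only re-land to refresh the hub olean; no declaration changed.)
-/

set_option autoImplicit false

noncomputable section

open MeasureTheory Real

namespace Summit.QuantumFields.YangMills.Theorems.FemtoTransferGap.RateTube

variable {X : Type*} [MeasurableSpace X] {μ : Measure X}

/-! ## §1 Moment forms of the two prelim inequalities, and Cauchy–Schwarz -/

/-- First-order expansion of an exponential moment, MOMENT form: for `|E' − E| ≤ 1` on `{q ≠ 0}`, `0 ≤ ∫qe^{E'} − ∫qe^{E} − ∫qe^{E}(E'−E) ≤ ∫qe^{E}(E'−E)²`. [folklore] -/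
theorem exp_moment_first_order_var {q E E' A : X → ℝ} (hq0 : ∀ x, 0 ≤ q x) (hA : A = fun x => E' x - E x)
    (hI : Integrable (fun x => q x * Real.exp (E x)) μ) (hI' : Integrable (fun x => q x * Real.exp (E' x)) μ)
    (hIA : Integrable (fun x => q x * Real.exp (E x) * A x) μ) (hIA2 : Integrable (fun x => q x * Real.exp (E x) * A x ^ 2) μ) (hb : ∀ x, q x ≠ 0 → |A x| ≤ 1) :
    0 ≤ (∫ x, q x * Real.exp (E' x) ∂μ) - (∫ x, q x * Real.exp (E x) ∂μ) - ∫ x, q x * Real.exp (E x) * A x ∂μ ∧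
      (∫ x, q x * Real.exp (E' x) ∂μ) - (∫ x, q x * Real.exp (E x) ∂μ) - ∫ x, q x * Real.exp (E x) * A x ∂μ ≤ ∫ x, q x * Real.exp (E x) * A x ^ 2 ∂μ := by
  have e1 : (fun x => q x * Real.exp (E x) * (Real.exp (A x) - 1 - A x)) = fun x => (q x * Real.exp (E' x) - q x * Real.exp (E x)) - q x * Real.exp (E x) * A x := by
    funext x; simp only [hA]
    have : Real.exp (E' x) = Real.exp (E x) * Real.exp (E' x - E x) := by rw [← Real.exp_add]; ring_nf
    rw [this]; ring
  have hint12 : Integrable (fun x => q x * Real.exp (E' x) - q x * Real.exp (E x)) μ := hI'.sub hI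
  have hint : Integrable (fun x => q x * Real.exp (E x) * (Real.exp (A x) - 1 - A x)) μ := by rw [e1]; exact hint12.sub hIA
  have e : ∫ x, q x * Real.exp (E x) * (Real.exp (A x) - 1 - A x) ∂μ =
      (∫ x, q x * Real.exp (E' x) ∂μ) - (∫ x, q x * Real.exp (E x) ∂μ) - ∫ x, q x * Real.exp (E x) * A x ∂μ := by
    rw [e1, integral_sub hint12 hIA, integral_sub hI' hI]
  have hpt : ∀ x, 0 ≤ q x * Real.exp (E x) * (Real.exp (A x) - 1 - A x) ∧
      q x * Real.exp (E x) * (Real.exp (A x) - 1 - A x) ≤ q x * Real.exp (E x) * A x ^ 2 := fun x => by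
    by_cases hx : q x = 0
    · simp [hx]
    · have h0 : 0 ≤ q x * Real.exp (E x) := mul_nonneg (hq0 x) (Real.exp_pos _).le
      have h1 : 0 ≤ Real.exp (A x) - 1 - A x := by linarith [Real.add_one_le_exp (A x)]
      have h2 : Real.exp (A x) - 1 - A x ≤ A x ^ 2 := (le_abs_self _).trans (Real.abs_exp_sub_one_sub_id_le (hb x hx))
      exact ⟨mul_nonneg h0 h1, mul_le_mul_of_nonneg_left h2 h0⟩
  rw [← e]
  exact ⟨integral_nonneg fun x => (hpt x).1, integral_mono hint hIA2 fun x => (hpt x).2⟩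

/-- ★★ **Monotone covariance under an exponential tilt, MOMENT form**: `ρ ≥ 0` integrable, `|Z| ≤ c` on `{ρ ≠ 0}`, `ρe^{Z}` integrable:
`0 ≤ (∫ρ)(∫ρe^{Z}Z) − (∫ρe^{Z})(∫ρZ) ≤ e^{c}(∫ρ)(∫ρZ²)`. [folklore] -/
theorem exp_tilt_covariance_var {ρ Z : X → ℝ} (hρ0 : ∀ x, 0 ≤ ρ x) (hρ : Integrable ρ μ) (hmZ : Measurable Z) (hIe : Integrable (fun x => ρ x * Real.exp (Z x)) μ)
    {c : ℝ} (hb : ∀ x, ρ x ≠ 0 → |Z x| ≤ c) :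
    0 ≤ (∫ x, ρ x ∂μ) * (∫ x, ρ x * Real.exp (Z x) * Z x ∂μ) - (∫ x, ρ x * Real.exp (Z x) ∂μ) * (∫ x, ρ x * Z x ∂μ) ∧
      (∫ x, ρ x ∂μ) * (∫ x, ρ x * Real.exp (Z x) * Z x ∂μ) - (∫ x, ρ x * Real.exp (Z x) ∂μ) * (∫ x, ρ x * Z x ∂μ) ≤
        Real.exp c * (∫ x, ρ x ∂μ) * ∫ x, ρ x * Z x ^ 2 ∂μ := by
  have hIZ : Integrable (fun x => ρ x * Z x) μ := integrable_mul_of_abs_le_on_support hρ hmZ hb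
  have hIZZ : Integrable (fun x => ρ x * Z x ^ 2) μ :=
    integrable_mul_of_abs_le_on_support hρ (hmZ.pow_const 2) (C := c ^ 2) fun x hx => by
      rw [abs_pow]; exact pow_le_pow_left₀ (abs_nonneg _) (hb x hx) 2
  have hIeZ : Integrable (fun x => ρ x * Real.exp (Z x) * Z x) μ :=
    integrable_mul_of_abs_le_on_support hIe hmZ fun x hx => hb x (left_ne_zero_of_mul hx)
  obtain ⟨F, hF⟩ : ∃ F : ℝ, F = ∫ x, ρ x ∂μ := ⟨_, rfl⟩
  obtain ⟨G, hG⟩ : ∃ F : ℝ, F = ∫ x, ρ x * Real.exp (Z x) ∂μ := ⟨_, rfl⟩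
  obtain ⟨I, hI⟩ : ∃ F : ℝ, F = ∫ x, ρ x * Z x ∂μ := ⟨_, rfl⟩
  obtain ⟨J, hJ⟩ : ∃ F : ℝ, F = ∫ x, ρ x * Real.exp (Z x) * Z x ∂μ := ⟨_, rfl⟩
  obtain ⟨S, hS⟩ : ∃ F : ℝ, F = ∫ x, ρ x * Z x ^ 2 ∂μ := ⟨_, rfl⟩
  rw [← hF, ← hG, ← hI, ← hJ, ← hS]
  have hF0 : 0 ≤ F := by rw [hF]; exact integral_nonneg hρ0
  have hS0 : 0 ≤ S := by rw [hS]; exact integral_nonneg fun x => mul_nonneg (hρ0 x) (sq_nonneg _)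
  have hIb : |I| ≤ c * F := by
    rw [hI, hF]
    have hpt : ∀ x, |ρ x * Z x| ≤ c * ρ x := fun x => by
      by_cases hx : ρ x = 0
      · rw [hx]; simp
      · rw [abs_mul, abs_of_nonneg (hρ0 x), mul_comm]; exact mul_le_mul_of_nonneg_right (hb x hx) (hρ0 x)
    calc |∫ x, ρ x * Z x ∂μ| ≤ ∫ x, |ρ x * Z x| ∂μ := abs_integral_le_integral_abs
      _ ≤ ∫ x, c * ρ x ∂μ := integral_mono hIZ.abs (hρ.const_mul c) hpt
      _ = c * ∫ x, ρ x ∂μ := integral_const_mul _ _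
  by_cases hF00 : F = 0
  · have hae : ρ =ᵐ[μ] 0 := (integral_eq_zero_iff_of_nonneg (fun x => hρ0 x) hρ).mp (by rw [← hF]; exact hF00)
    have hG0 : G = 0 := by
      rw [hG]; refine (integral_congr_ae (hae.mono fun x hx => ?_)).trans (integral_zero _ _)
      simp [hx]
    rw [hF00, hG0]; simp
  have hFp : 0 < F := lt_of_le_of_ne hF0 (Ne.symm hF00)
  obtain ⟨m, hm⟩ : ∃ m : ℝ, m = I / F := ⟨_, rfl⟩
  have hmF : m * F = I := by rw [hm]; field_simp
  have hm_b : |m| ≤ c := by rw [hm, abs_div, abs_of_pos hFp, div_le_iff₀ hFp]; exact hIb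
  have e : (fun x => ρ x * ((Real.exp (Z x) - Real.exp m) * (Z x - m))) =
      fun x => ρ x * Real.exp (Z x) * Z x - m * (ρ x * Real.exp (Z x)) - Real.exp m * (ρ x * Z x) + (Real.exp m * m) * ρ x := by
    funext x; ring
  have hA1 : Integrable (fun x => ρ x * Real.exp (Z x) * Z x - m * (ρ x * Real.exp (Z x))) μ := hIeZ.sub (hIe.const_mul m)
  have hA2 : Integrable (fun x => ρ x * Real.exp (Z x) * Z x - m * (ρ x * Real.exp (Z x)) - Real.exp m * (ρ x * Z x)) μ := hA1.sub (hIZ.const_mul _)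
  have hcov_eq : F * J - G * I = F * ∫ x, ρ x * ((Real.exp (Z x) - Real.exp m) * (Z x - m)) ∂μ := by
    rw [e, integral_add hA2 (hρ.const_mul _), integral_sub hA1 (hIZ.const_mul _), integral_sub hIeZ (hIe.const_mul m),
      integral_const_mul, integral_const_mul, integral_const_mul, ← hJ, ← hG, ← hI, ← hF, ← hmF]
    ring
  have hpt : ∀ x, 0 ≤ ρ x * ((Real.exp (Z x) - Real.exp m) * (Z x - m)) ∧
      ρ x * ((Real.exp (Z x) - Real.exp m) * (Z x - m)) ≤ Real.exp c * (ρ x * (Z x - m) ^ 2) := fun x => by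
    by_cases hx : ρ x = 0
    · rw [hx]; simp
    · have h := mul_exp_sub_exp_le (abs_le.mp (hb x hx)).2 (abs_le.mp hm_b).2
      refine ⟨mul_nonneg (hρ0 x) h.1, ?_⟩
      calc ρ x * ((Real.exp (Z x) - Real.exp m) * (Z x - m)) ≤ ρ x * (Real.exp c * (Z x - m) ^ 2) := mul_le_mul_of_nonneg_left h.2 (hρ0 x)
        _ = Real.exp c * (ρ x * (Z x - m) ^ 2) := by ring
  have hIsq : Integrable (fun x => ρ x * (Z x - m) ^ 2) μ :=
    integrable_mul_of_abs_le_on_support hρ ((hmZ.sub measurable_const).pow_const 2) (C := (2 * c) ^ 2) fun x hx => by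
      rw [abs_pow]; refine pow_le_pow_left₀ (abs_nonneg _) ?_ 2
      exact (abs_sub _ _).trans (by linarith [hb x hx, hm_b])
  have hIcov : Integrable (fun x => ρ x * ((Real.exp (Z x) - Real.exp m) * (Z x - m))) μ := by rw [e]; exact hA2.add (hρ.const_mul _)
  -- `∫ρ(Z − m)² = S − m²F ≤ S`
  have hvar : ∫ x, ρ x * (Z x - m) ^ 2 ∂μ ≤ S := by
    have e2 : (fun x => ρ x * (Z x - m) ^ 2) = fun x => ρ x * Z x ^ 2 - (2 * m) * (ρ x * Z x) + m ^ 2 * ρ x := by funext x; ring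
    have hB1 : Integrable (fun x => ρ x * Z x ^ 2 - (2 * m) * (ρ x * Z x)) μ := hIZZ.sub (hIZ.const_mul _)
    have hmm : 0 ≤ m ^ 2 * F := mul_nonneg (sq_nonneg m) hF0
    rw [e2, integral_add hB1 (hρ.const_mul _), integral_sub hIZZ (hIZ.const_mul _), integral_const_mul, integral_const_mul, ← hI, ← hF, ← hS, ← hmF]
    have : -(2 * m * (m * F)) + m ^ 2 * F = -(m ^ 2 * F) := by ring
    linarith [hmm, this]
  rw [hcov_eq]
  refine ⟨mul_nonneg hF0 (integral_nonneg fun x => (hpt x).1), ?_⟩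
  have hstep : ∫ x, ρ x * ((Real.exp (Z x) - Real.exp m) * (Z x - m)) ∂μ ≤ Real.exp c * S := by
    refine (integral_mono hIcov (hIsq.const_mul (Real.exp c)) fun x => (hpt x).2).trans ?_
    rw [integral_const_mul]; exact mul_le_mul_of_nonneg_left hvar (Real.exp_pos _).le
  calc F * ∫ x, ρ x * ((Real.exp (Z x) - Real.exp m) * (Z x - m)) ∂μ ≤ F * (Real.exp c * S) := mul_le_mul_of_nonneg_left hstep hF0
    _ = Real.exp c * F * S := by ring

/-- **Cauchy–Schwarz for a weighted mean**: `(∫ρA)² ≤ (∫ρ)·(∫ρA²)` for `ρ ≥ 0` (all three integrands integrable). [folklore] -/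
theorem sq_integral_mul_le {ρ A : X → ℝ} (hρ0 : ∀ x, 0 ≤ ρ x) (hρ : Integrable ρ μ) (hIA : Integrable (fun x => ρ x * A x) μ)
    (hIA2 : Integrable (fun x => ρ x * A x ^ 2) μ) :
    (∫ x, ρ x * A x ∂μ) ^ 2 ≤ (∫ x, ρ x ∂μ) * ∫ x, ρ x * A x ^ 2 ∂μ := by
  obtain ⟨F, hF⟩ : ∃ F : ℝ, F = ∫ x, ρ x ∂μ := ⟨_, rfl⟩
  obtain ⟨I, hI⟩ : ∃ F : ℝ, F = ∫ x, ρ x * A x ∂μ := ⟨_, rfl⟩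
  obtain ⟨S, hS⟩ : ∃ F : ℝ, F = ∫ x, ρ x * A x ^ 2 ∂μ := ⟨_, rfl⟩
  rw [← hF, ← hI, ← hS]
  have hF0 : 0 ≤ F := by rw [hF]; exact integral_nonneg hρ0
  by_cases hF00 : F = 0
  · have hae : ρ =ᵐ[μ] 0 := (integral_eq_zero_iff_of_nonneg (fun x => hρ0 x) hρ).mp (by rw [← hF]; exact hF00)
    have hI0 : I = 0 := by
      rw [hI]; refine (integral_congr_ae (hae.mono fun x hx => ?_)).trans (integral_zero _ _)
      simp [hx]
    rw [hF00, hI0]; simp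
  have hFp : 0 < F := lt_of_le_of_ne hF0 (Ne.symm hF00)
  -- `0 ≤ ∫ρ(A·F − I)² = F(F·S − I²)`
  have e : (fun x => ρ x * (A x * F - I) ^ 2) = fun x => F ^ 2 * (ρ x * A x ^ 2) - (2 * F * I) * (ρ x * A x) + I ^ 2 * ρ x := by funext x; ring
  have h1 : Integrable (fun x => F ^ 2 * (ρ x * A x ^ 2) - (2 * F * I) * (ρ x * A x)) μ := (hIA2.const_mul _).sub (hIA.const_mul _)
  have hnn : 0 ≤ ∫ x, ρ x * (A x * F - I) ^ 2 ∂μ := integral_nonneg fun x => mul_nonneg (hρ0 x) (sq_nonneg _)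
  rw [e, integral_add h1 (hρ.const_mul _), integral_sub (hIA2.const_mul _) (hIA.const_mul _), integral_const_mul, integral_const_mul, integral_const_mul,
    ← hS, ← hI, ← hF] at hnn
  have h2 : F ^ 2 * S - 2 * F * I * I + I ^ 2 * F = F * (F * S - I ^ 2) := by ring
  rw [h2] at hnn
  nlinarith [(mul_nonneg_iff_of_pos_left hFp).mp hnn]

end Summit.QuantumFields.YangMills.Theorems.FemtoTransferGap.RateTube

end
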